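import Literature.AnabelianGeometry.EtaleTheta.Discharge.Sec2Cor28iiiOuterAssembly
import HarnessLib

/-!
# [EtTh] Cor 2.8 (iii) at the §1 model, OUTER case: the stability binders of the automorphism pair
# `(α, β)` are consequences of Cor 2.8 (iii)'s own hypotheses (binder reduction, support lemmas)

Mochizuki, *The Étale Theta Function …* [EtTh], Publ. RIMS 45 (2009), §2, Cor 2.8 (iii), PRIMS PDF p.42
(bib key `MochizukiEtTh2009`): "if `γ` arises from an inner automorphism of `Π^tp_{Ċ̲̲}` (resp. `Π^tp_{Ċ̲}`),
then `γ` preserves `η̲̈^{Θ,l·ℤ}` (resp. `η̈^{Θ,l·ℤ}`)"; Def 2.1 p.36 "`Π_{X̲} = Π_{X̲̲}·Δ̄_Θ`, `Π_{C̲} = Π_{C̲̲}·Δ̄_Θ`",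
Def 2.3 p.38 (`Π_{X̲̲} = Π_{C̲̲} ∩ Π_X`).

PROOF-ONLY support file (no `def`, no instance, no new `Prop`; cell abc-iut, layer L2, seat abc-iut-w6-d051,
sequel «S1b» of `Sec2OrbitEmbeddingOuterTransport` (S1) for abc-iut-w6-d049's OUTER assembly of node
EtTh:Cor2.8(iii) clauses 3–4; W3-L2-02 lineage abc-iut-L2-t2 / abc-iut-L2-d3). S1 reads the transport by
`(γ_x, Γ_Θ)`, `x ∈ Π^tp_C`, through a pair `α : Π^tp_X ≃ₜ* Π^tp_X` (`ι ∘ α = conj_x ∘ ι`),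
`β : (Π^tp_X)^Θ ≃ₜ* (Π^tp_X)^Θ` (`β ∘ toTheta = toTheta ∘ α`) and asks for the STABILITY binders
`β^{±1}(Δ_Θ) ⊆ Δ_Θ`, `α^{±1}(Π^tp_Ÿ) ⊆ Π^tp_Ÿ`, `α^{±1}(Π^tp_{X̲̲}) ⊆ Π^tp_{X̲̲}`, `α^{±1}(Π^tp_{X̲}) ⊆ Π^tp_{X̲}`.
THIS file DERIVES them from the hypotheses `ThetaOrbitData.Cor28_iii` itself carries and from the
`CoverData` axioms of abc-iut-L2-t2's `TemperedCoverData`: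
* `TemperedCoverData.conj_mem_PiXuu`, `mem_normalizer_PiXuu` — `Π_{C̲̲}` normalises
  `Π_{X̲̲} = Π_{C̲̲} ∩ Π_X` (`Π_X ⊴ Π_C`); `map_conj_PiXu_le`, `mem_normalizer_PiXu` — `Π_{C̲} = Π_{C̲̲}·Δ̄_Θ`
  normalises `Π_{X̲} = Π_{X̲̲}·Δ̄_Θ` (`Δ̄_Θ ⊴ Π_C`); `mem_tp_iff_conj_mem` — pulled back to `Π^tp_C` along `toHat`;
* `OrbitEmbedding.conj_mem_iff_of_map_eq` — a `γ_x`-stable subgroup of `Π^tp_C` is `x`-normalised;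
  `stab_of_map_ι_eq` — the engine: if `ι(H) = H'` and `x` normalises `H'` then `α^{±1}(H) ⊆ H`;
* `stab_GtpYdd_of_map_PiYddtp` — from Cor 2.8 (iii)'s binder `hY : γ_x(Π^tp_Ÿ) = Π^tp_Ÿ` (of `T`);
* `stab_Huu_of_mem_tp_PiCuu` — from clause 3's membership `x ∈ Π^tp_{C̲̲}`;
  `stab_GtpXu_of_mem_tp_PiCu` — from clause 4's membership `x ∈ Π^tp_{C̲}` (under abc-iut-L2-t2's
  identification `ι(Π^tp_{X̲}) = T.tp T.PiXu`, as in clause 2 of p427195);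
* `stab_DeltaTheta_of_induces` — `β^{±1}(Δ_Θ) ⊆ Δ_Θ` from `InducesOnTheta (γ_x) Γ_Θ` (its first
  component `γ_x(top) = top`), `ι`-injectivity and `toTheta`-surjectivity.
* `stab_Huu_of_map_tp_PiXuu`, `stab_GtpXu_of_map_tp_PiXu` — the same from Cor 2.8 (i)'s tower-stability
  binders `γ_x(Π^tp_{X̲̲}) = Π^tp_{X̲̲}`, `γ_x(Π^tp_{X̲}) = Π^tp_{X̲}` (of `T`);
* **S1c, the REDUCED capstones** over abc-iut-w6-d049's assembly `Sec2Cor28iiiOuterAssembly` (p436513):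
  `ofEmbedding_cor28_iii_outer_reduced` — conjuncts 3–4 of `ThetaOrbitData.Cor28_iii` at `ofEmbedding`, with
  the clause memberships `x ∈ Π^tp_{Ċ̲̲}` / `x ∈ Π^tp_{Ċ̲}` now LOAD-BEARING (they supply `hU`/`hXu` and
  `x ∈ Π^tp_Ċ`), binders = Cor 2.8 (iii)'s own + the pair equations `hα`, `hβ` + `hXuι` + P-C5 (`σ₀`, `hη`,
  quantified over the membership proofs it mentions — all instances are equal by proof irrelevance);
  `ofEmbedding_cor28_i_outer_reduced` — likewise for `Cor28_i`'s four conclusions (κ = 1).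
So the OUTER clauses hold modulo exactly: the pair equations for `(α, β)` (data of abc-iut-L2-d3's model:
`MuTwoSetting.CLevelData.conjX`, `Thm16Sub` companions) and the P-C5 identity (abc-iut-w6-d049's S2,
GAP-LEDGER G-w6d049-1).
HONEST FRAMING: [EtTh] is refereed; statements about the TYPED interface only; no side is taken on
[IUTchIII] Cor 3.12; typed ≠ proved.
-/

noncomputable section

namespace Literature.AnabelianGeometry.EtaleTheta

open Literature.AnabelianGeometry.SemiGraphs ThetaCovers Literature.IUT.HodgeArakelov

universe u

/-! ### `Π_{C̲̲}` normalises `Π_{X̲̲}`; `Π_{C̲}` normalises `Π_{X̲}` (CoverData axioms) -/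

namespace ThetaCovers.TemperedCoverData

variable {l : ℕ} (T : TemperedCoverData.{u} l)

/-- For `c ∈ Π_{C̲̲}`: `c · Π_{X̲̲} · c⁻¹ ⊆ Π_{X̲̲}` (`Π_{X̲̲} = Π_{C̲̲} ∩ Π_X`, `Π_X ⊴ Π_C`).
[cite: MochizukiEtTh2009, Def 2.3 p.38] -/
theorem conj_mem_PiXuu {c : T.PiC} (hc : c ∈ T.PiCuu) {h : T.PiC} (hh : h ∈ T.PiXuu) :
    c * h * c⁻¹ ∈ T.PiXuu :=
  Subgroup.mem_inf.2 ⟨T.PiCuu.mul_mem (T.PiCuu.mul_mem hc (Subgroup.mem_inf.1 hh).1) (T.PiCuu.inv_mem hc),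
    T.PiX_normal.conj_mem _ (Subgroup.mem_inf.1 hh).2 c⟩

/-- `Π_{C̲̲} ⊆ N_{Π_C}(Π_{X̲̲})`. [cite: MochizukiEtTh2009, Def 2.3 p.38] -/
theorem mem_normalizer_PiXuu {c : T.PiC} (hc : c ∈ T.PiCuu) : c ∈ Subgroup.normalizer (T.PiXuu : Set T.PiC) := by
  rw [Subgroup.mem_normalizer_iff]
  intro h
  refine ⟨fun hh => T.conj_mem_PiXuu hc hh, fun hh => ?_⟩
  have h' := T.conj_mem_PiXuu (T.PiCuu.inv_mem hc) hh
  simp only [inv_inv] at h'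
  have : c⁻¹ * (c * h * c⁻¹) * c = h := by group
  rwa [this] at h'

/-- For `c ∈ Π_{C̲̲}`: `c · Π_{X̲} · c⁻¹ ⊆ Π_{X̲}` (`Π_{X̲} = Π_{X̲̲}·Δ̄_Θ`, `Δ̄_Θ ⊴ Π_C`).
[cite: MochizukiEtTh2009, Def 2.1 p.36] -/
theorem map_conj_PiXu_le {c : T.PiC} (hc : c ∈ T.PiCuu) :
    T.PiXu.map (MulAut.conj c).toMonoidHom ≤ T.PiXu := by
  rw [TemperedCoverData.PiXu, Subgroup.map_sup]
  refine sup_le (le_sup_of_le_left ?_) (le_sup_of_le_right ?_)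
  · rintro _ ⟨h, hh, rfl⟩
    exact T.conj_mem_PiXuu hc hh
  · rintro _ ⟨t, ht, rfl⟩
    exact T.barTheta_normal.conj_mem _ ht c

/-- `Π_{C̲} = Π_{C̲̲}·Δ̄_Θ ⊆ N_{Π_C}(Π_{X̲})`. [cite: MochizukiEtTh2009, Def 2.1 p.36] -/
theorem mem_normalizer_PiXu {c : T.PiC} (hc : c ∈ T.PiCu) : c ∈ Subgroup.normalizer (T.PiXu : Set T.PiC) := by
  have hle : T.PiCu ≤ Subgroup.normalizer (T.PiXu : Set T.PiC) := by
    refine sup_le (fun c hc => ?_) (le_trans le_sup_right Subgroup.le_normalizer)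
    rw [Subgroup.mem_normalizer_iff]
    intro h
    refine ⟨fun hh => T.map_conj_PiXu_le hc ⟨h, hh, rfl⟩, fun hh => ?_⟩
    have h' : c⁻¹ * (c * h * c⁻¹) * c⁻¹⁻¹ ∈ T.PiXu := T.map_conj_PiXu_le (T.PiCuu.inv_mem hc) ⟨_, hh, rfl⟩
    have : c⁻¹ * (c * h * c⁻¹) * c⁻¹⁻¹ = h := by group
    rwa [this] at h'
  exact hle hc

/-- Pull-back along `toHat`: if `toHat x` normalises `H ≤ Π_C` then `x` normalises `T.tp H = toHat⁻¹(H)`.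
[cite: MochizukiEtTh2009, Prop 2.4 p.38] -/
theorem mem_tp_iff_conj_mem {H : Subgroup T.PiC} {x : T.Gtp} (hx : T.toHat x ∈ Subgroup.normalizer (H : Set T.PiC))
    (g : T.Gtp) : g ∈ T.tp H ↔ x * g * x⁻¹ ∈ T.tp H := by
  change T.toHat g ∈ H ↔ T.toHat (x * g * x⁻¹) ∈ H
  rw [map_mul, map_mul, map_inv]
  exact (Subgroup.mem_normalizer_iff.1 hx) (T.toHat g)

/-- `x ∈ Π^tp_{C̲̲}` normalises `Π^tp_{X̲̲}` (of `T`). [cite: MochizukiEtTh2009, Def 2.3 p.38] -/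
theorem mem_tp_PiXuu_iff_of_mem_tp_PiCuu {x : T.Gtp} (hx : x ∈ T.tp T.PiCuu) (g : T.Gtp) :
    g ∈ T.tp T.PiXuu ↔ x * g * x⁻¹ ∈ T.tp T.PiXuu :=
  T.mem_tp_iff_conj_mem (T.mem_normalizer_PiXuu hx) g

/-- `x ∈ Π^tp_{C̲}` normalises `Π^tp_{X̲}` (of `T`). [cite: MochizukiEtTh2009, Def 2.1 p.36] -/
theorem mem_tp_PiXu_iff_of_mem_tp_PiCu {x : T.Gtp} (hx : x ∈ T.tp T.PiCu) (g : T.Gtp) :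
    g ∈ T.tp T.PiXu ↔ x * g * x⁻¹ ∈ T.tp T.PiXu :=
  T.mem_tp_iff_conj_mem (T.mem_normalizer_PiXu hx) g

end ThetaCovers.TemperedCoverData

/-! ### The stability binders of the pair `(α, β)` from Cor 2.8 (iii)'s own hypotheses -/

namespace ThetaSetting.EtaleThetaData.DoubleUnderline.OrbitEmbedding

variable {p : ℕ} [Fact p.Prime] {D : ThetaSetting p} {E : D.EtaleThetaData} {l : ℕ}
  {C : E.DoubleUnderline l} {T : TemperedCoverData.{u} l} (ε : C.OrbitEmbedding T)
  {x : T.Gtp} {α : D.PiTemp ≃ₜ* D.PiTemp} {β : D.GtpTheta ≃ₜ* D.GtpTheta}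

omit [Fact p.Prime] in
/-- A `γ_x`-STABLE subgroup `H'` of `Π^tp_C` (`γ_x(H') = H'`, the shape of Cor 2.8's binders `hY`, `hYuu`
and of `InducesOnTheta`'s first component) is `x`-normalised: `y ∈ H' ↔ x·y·x⁻¹ ∈ H'`.
[cite: MochizukiEtTh2009, Cor 2.8(iii) p.42] -/
theorem conj_mem_iff_of_map_eq {l : ℕ} {T : TemperedCoverData.{u} l} {x : T.Gtp} {H' : Subgroup T.Gtp}
    (h : H'.map (ThetaOrbitData.innerAutTop x).toMulEquiv.toMonoidHom = H') (y : T.Gtp) :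
    y ∈ H' ↔ x * y * x⁻¹ ∈ H' := by
  refine ⟨fun hy => h.le ⟨y, hy, rfl⟩, fun hy => ?_⟩
  obtain ⟨y', hy', hyy⟩ := h.ge hy
  have : y' = y := by
    have hyy' : x * y' * x⁻¹ = x * y * x⁻¹ := hyy
    simpa using hyy'
  exact this ▸ hy'

/-- **The engine**: if `ι(H) = H'` and `x` normalises `H'`, then `α(H) ⊆ H` and `α⁻¹(H) ⊆ H`
(`ι ∘ α = conj_x ∘ ι`, `ι` injective). [cite: MochizukiEtTh2009, Cor 2.8(iii) p.42] -/
theorem stab_of_map_ι_eq (hα : ∀ g, ε.ι (α g) = x * ε.ι g * x⁻¹) {H : Subgroup D.PiTemp}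
    {H' : Subgroup T.Gtp} (hH : H.map ε.ι = H') (hnorm : ∀ y, y ∈ H' ↔ x * y * x⁻¹ ∈ H') :
    (∀ g, g ∈ H → α g ∈ H) ∧ (∀ g, g ∈ H → α.symm g ∈ H) := by
  have key : ∀ g : D.PiTemp, ε.ι g ∈ H' → g ∈ H := fun g hg => by
    obtain ⟨g', hg', hgg⟩ := hH.ge hg
    exact ε.injective_ι hgg ▸ hg'
  refine ⟨fun g hg => key _ ?_, fun g hg => key _ ?_⟩
  · rw [hα]
    exact (hnorm _).1 (hH.le ⟨g, hg, rfl⟩)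
  · rw [ε.ι_symm_eq hα]
    refine (hnorm _).2 ?_
    have : x * (x⁻¹ * ε.ι g * x) * x⁻¹ = ε.ι g := by group
    rw [this]
    exact hH.le ⟨g, hg, rfl⟩

/-- **`α^{±1}(Π^tp_Ÿ) ⊆ Π^tp_Ÿ` from Cor 2.8 (iii)'s binder `hY : γ_x(Π^tp_Ÿ) = Π^tp_Ÿ`** (of `T`;
`ι(Π^tp_Ÿ) = T.PiYddtp`). [cite: MochizukiEtTh2009, Cor 2.8(iii) p.42] -/
theorem stab_GtpYdd_of_map_PiYddtp (hα : ∀ g, ε.ι (α g) = x * ε.ι g * x⁻¹)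
    (hYmap : T.PiYddtp.map (ThetaOrbitData.innerAutTop x).toMulEquiv.toMonoidHom = T.PiYddtp) :
    (∀ g, g ∈ D.GtpYdd → α g ∈ D.GtpYdd) ∧ (∀ g, g ∈ D.GtpYdd → α.symm g ∈ D.GtpYdd) :=
  ε.stab_of_map_ι_eq hα ε.map_GtpYdd (conj_mem_iff_of_map_eq hYmap)

/-- **`α^{±1}(Π^tp_{X̲̲}) ⊆ Π^tp_{X̲̲}` from clause 3's membership `x ∈ Π^tp_{C̲̲}`** (`ι(Π^tp_{X̲̲}) = Π^tp_{X̲̲}`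
of `T`, `Π_{C̲̲}` normalises `Π_{X̲̲}`). [cite: MochizukiEtTh2009, Cor 2.8(iii) p.42] -/
theorem stab_Huu_of_mem_tp_PiCuu (hα : ∀ g, ε.ι (α g) = x * ε.ι g * x⁻¹) (hx : x ∈ T.tp T.PiCuu) :
    (∀ g, g ∈ C.Huu → α g ∈ C.Huu) ∧ (∀ g, g ∈ C.Huu → α.symm g ∈ C.Huu) :=
  ε.stab_of_map_ι_eq hα ε.map_Huu (T.mem_tp_PiXuu_iff_of_mem_tp_PiCuu hx)

/-- **`α^{±1}(Π^tp_{X̲}) ⊆ Π^tp_{X̲}` from clause 4's membership `x ∈ Π^tp_{C̲}`**, under abc-iut-L2-t2's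
identification `ι(Π^tp_{X̲}) = T.tp T.PiXu` of the single-underline subgroup (as in clause 2 of p427195).
[cite: MochizukiEtTh2009, Cor 2.8(iii) p.42] -/
theorem stab_GtpXu_of_mem_tp_PiCu (hXuι : (D.GtpXu l).map ε.ι = T.tp T.PiXu)
    (hα : ∀ g, ε.ι (α g) = x * ε.ι g * x⁻¹) (hx : x ∈ T.tp T.PiCu) :
    (∀ g, g ∈ D.GtpXu l → α g ∈ D.GtpXu l) ∧ (∀ g, g ∈ D.GtpXu l → α.symm g ∈ D.GtpXu l) :=
  ε.stab_of_map_ι_eq hα hXuι (T.mem_tp_PiXu_iff_of_mem_tp_PiCu hx)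

/-- `α^{±1}(toTheta⁻¹ Δ_Θ) ⊆ toTheta⁻¹ Δ_Θ` from `InducesOnTheta (γ_x) Γ_Θ` (its component `γ_x(top) = top`,
`top = ι(toTheta⁻¹ Δ_Θ)`). [cite: MochizukiEtTh2009, Cor 2.8(i) p.42] -/
theorem stab_comap_DeltaTheta_of_induces (hC : D.Compat) (hS : D.Sec2Hyps)
    (hα : ∀ g, ε.ι (α g) = x * ε.ι g * x⁻¹)
    {ΓΘ : (ThetaOrbitData.ofEmbedding ε hC hS).DeltaTheta ≃* (ThetaOrbitData.ofEmbedding ε hC hS).DeltaTheta}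
    (hind : (ThetaOrbitData.ofEmbedding ε hC hS).InducesOnTheta (ThetaOrbitData.innerAutTop x) ΓΘ) :
    (∀ g, g ∈ D.DeltaTheta.comap D.toTheta → α g ∈ D.DeltaTheta.comap D.toTheta) ∧
      (∀ g, g ∈ D.DeltaTheta.comap D.toTheta → α.symm g ∈ D.DeltaTheta.comap D.toTheta) := by
  obtain ⟨hΓ, -⟩ := hind
  exact ε.stab_of_map_ι_eq hα (H' := ε.top) rfl (conj_mem_iff_of_map_eq hΓ)

/-- **`β^{±1}(Δ_Θ) ⊆ Δ_Θ` from `InducesOnTheta (γ_x) Γ_Θ`** and the pair equations (`toTheta` surjective).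
[cite: MochizukiEtTh2009, Cor 2.8(i) p.42] -/
theorem stab_DeltaTheta_of_induces (hC : D.Compat) (hS : D.Sec2Hyps)
    (hα : ∀ g, ε.ι (α g) = x * ε.ι g * x⁻¹) (hβ : ∀ g, β (D.toTheta g) = D.toTheta (α g))
    {ΓΘ : (ThetaOrbitData.ofEmbedding ε hC hS).DeltaTheta ≃* (ThetaOrbitData.ofEmbedding ε hC hS).DeltaTheta}
    (hind : (ThetaOrbitData.ofEmbedding ε hC hS).InducesOnTheta (ThetaOrbitData.innerAutTop x) ΓΘ) :
    (∀ a, a ∈ D.DeltaTheta → β a ∈ D.DeltaTheta) ∧ (∀ a, a ∈ D.DeltaTheta → β.symm a ∈ D.DeltaTheta) := by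
  obtain ⟨h₁, h₂⟩ := ε.stab_comap_DeltaTheta_of_induces hC hS hα hind
  refine ⟨fun a ha => ?_, fun a ha => ?_⟩
  · obtain ⟨g, rfl⟩ := D.toTheta_surjective a
    rw [hβ]
    exact h₁ g ha
  · obtain ⟨g, rfl⟩ := D.toTheta_surjective a
    rw [symm_toTheta_eq hβ]
    exact h₂ g ha

/-- `x` normalises `T.PiYddtp` and `Π^tp_{Ÿ̲̲} = T.PiYddtp ⊓ T.tp T.PiXuu` as soon as Cor 2.8 (iii)'s binders
`hY`, `hYuu` hold (membership forms of S1's `hmem`, `hmem'`, `hinv'`).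
[cite: MochizukiEtTh2009, Cor 2.8(iii) p.42] -/
theorem outer_mem_of_binders
    (hYmap : T.PiYddtp.map (ThetaOrbitData.innerAutTop x).toMulEquiv.toMonoidHom = T.PiYddtp)
    (hYuu : (T.PiYddtp ⊓ T.tp T.PiXuu).map (ThetaOrbitData.innerAutTop x).toMulEquiv.toMonoidHom =
      T.PiYddtp ⊓ T.tp T.PiXuu) :
    (∀ y : ↥T.PiYddtp, x * (y : T.Gtp) * x⁻¹ ∈ T.PiYddtp) ∧
    (∀ g : ↥(T.PiYddtp ⊓ T.tp T.PiXuu), x * (g : T.Gtp) * x⁻¹ ∈ T.PiYddtp ⊓ T.tp T.PiXuu) ∧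
    (∀ g : ↥(T.PiYddtp ⊓ T.tp T.PiXuu), x⁻¹ * (g : T.Gtp) * x ∈ T.PiYddtp ⊓ T.tp T.PiXuu) := by
  refine ⟨fun y => (conj_mem_iff_of_map_eq hYmap _).1 y.2, fun g => (conj_mem_iff_of_map_eq hYuu _).1 g.2,
    fun g => (conj_mem_iff_of_map_eq hYuu _).2 ?_⟩
  have : x * (x⁻¹ * (g : T.Gtp) * x) * x⁻¹ = g := by group
  rw [this]
  exact g.2

/-- `α^{±1}(Π^tp_{X̲̲}) ⊆ Π^tp_{X̲̲}` from the tower-stability binder `γ_x(Π^tp_{X̲̲}) = Π^tp_{X̲̲}` (of `T`;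
Cor 2.8 (i)'s shape `∀ S ∈ T.tower, γ(S) = S`). [cite: MochizukiEtTh2009, Cor 2.8(i) p.42] -/
theorem stab_Huu_of_map_tp_PiXuu (hα : ∀ g, ε.ι (α g) = x * ε.ι g * x⁻¹)
    (h : (T.tp T.PiXuu).map (ThetaOrbitData.innerAutTop x).toMulEquiv.toMonoidHom = T.tp T.PiXuu) :
    (∀ g, g ∈ C.Huu → α g ∈ C.Huu) ∧ (∀ g, g ∈ C.Huu → α.symm g ∈ C.Huu) :=
  ε.stab_of_map_ι_eq hα ε.map_Huu (conj_mem_iff_of_map_eq h)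

/-- `α^{±1}(Π^tp_{X̲}) ⊆ Π^tp_{X̲}` from the tower-stability binder `γ_x(Π^tp_{X̲}) = Π^tp_{X̲}` (of `T`), under
`ι(Π^tp_{X̲}) = T.tp T.PiXu`. [cite: MochizukiEtTh2009, Cor 2.8(i) p.42] -/
theorem stab_GtpXu_of_map_tp_PiXu (hXuι : (D.GtpXu l).map ε.ι = T.tp T.PiXu)
    (hα : ∀ g, ε.ι (α g) = x * ε.ι g * x⁻¹)
    (h : (T.tp T.PiXu).map (ThetaOrbitData.innerAutTop x).toMulEquiv.toMonoidHom = T.tp T.PiXu) :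
    (∀ g, g ∈ D.GtpXu l → α g ∈ D.GtpXu l) ∧ (∀ g, g ∈ D.GtpXu l → α.symm g ∈ D.GtpXu l) :=
  ε.stab_of_map_ι_eq hα hXuι (conj_mem_iff_of_map_eq h)

/-! ### S1c — the reduced capstones over abc-iut-w6-d049's assembly -/

/-- **Cor 2.8 (iii), conjuncts 3–4 of `ThetaOrbitData.Cor28_iii` at `ofEmbedding`, OUTER case, REDUCED
binders**: for `x` with an automorphism pair `(α, β)` through `ι` (`ι ∘ α = conj_x ∘ ι`,
`β ∘ toTheta = toTheta ∘ α`), the identification `ι(Π^tp_{X̲}) = T.tp T.PiXu`, and P-C5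
(`autMap α⁻¹ β⁻¹ η̈^Θ = σ₀·η̈^Θ`, `σ₀ ∈ Π^tp_{Ẋ̲̲} ∩ Π^tp_X`; stated for all membership proofs it mentions):
"if `γ` arises from an inner automorphism of `Π^tp_{Ċ̲̲}` (resp. `Π^tp_{Ċ̲}`), then `γ` preserves `η̲̈^{Θ,l·ℤ}`
(resp. `η̈^{Θ,l·ℤ}`)" — the clause memberships supply `α^{±1}`-stability of `Π^tp_{X̲̲}` (resp. `Π^tp_{X̲}`)
and `x ∈ Π^tp_Ċ`; `β^{±1}(Δ_Θ) ⊆ Δ_Θ` and `α^{±1}(Π^tp_Ÿ) ⊆ Π^tp_Ÿ` come from `InducesOnTheta` and `hY`.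
[cite: MochizukiEtTh2009, Cor 2.8(iii) p.42] -/
theorem ofEmbedding_cor28_iii_outer_reduced (hC : D.Compat) (hS : D.Sec2Hyps)
    (hα : ∀ g, ε.ι (α g) = x * ε.ι g * x⁻¹) (hβ : ∀ g, β (D.toTheta g) = D.toTheta (α g))
    (hXuι : (D.GtpXu l).map ε.ι = T.tp T.PiXu)
    (ΓΘ : (ThetaOrbitData.ofEmbedding ε hC hS).DeltaTheta ≃* (ThetaOrbitData.ofEmbedding ε hC hS).DeltaTheta)
    (hind : (ThetaOrbitData.ofEmbedding ε hC hS).InducesOnTheta (ThetaOrbitData.innerAutTop x) ΓΘ)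
    (hYmap : T.PiYddtp.map (ThetaOrbitData.innerAutTop x).toMulEquiv.toMonoidHom = T.PiYddtp)
    (hYuu : (T.PiYddtp ⊓ T.tp T.PiXuu).map (ThetaOrbitData.innerAutTop x).toMulEquiv.toMonoidHom =
      T.PiYddtp ⊓ T.tp T.PiXuu)
    {σ₀ : D.PiTemp} (hσ₀ : σ₀ ∈ ε.dotXuu)
    (hη : ∀ (hΔ' : ∀ a, a ∈ D.DeltaTheta → β.symm a ∈ D.DeltaTheta)
        (hY : ∀ g, g ∈ D.GtpYdd → α g ∈ D.GtpYdd),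
      haveI := hC.GtpYdd_normal
      ContH1Aut.autMap D.toTheta D.DeltaTheta α.symm β.symm (symm_toTheta_eq hβ) hΔ'
          (H := D.GtpYdd) (H' := D.GtpYdd) hY E.etaDd =
        ContH1.conj D.toTheta D.DeltaTheta σ₀ E.etaDd) :
    (x ∈ T.tp T.PiCuu ⊓ T.PiCdot →
      (ThetaOrbitData.ofEmbedding ε hC hS).transport _ _ hYuu ΓΘ (ThetaOrbitData.ofEmbedding ε hC hS).rootLZ =
        (ThetaOrbitData.ofEmbedding ε hC hS).rootLZ) ∧
    (x ∈ T.tp T.PiCu ⊓ T.PiCdot →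
      (ThetaOrbitData.ofEmbedding ε hC hS).transport _ _ hYmap ΓΘ (ThetaOrbitData.ofEmbedding ε hC hS).etaLZ =
        (ThetaOrbitData.ofEmbedding ε hC hS).etaLZ) := by
  obtain ⟨hΔ, hΔ'⟩ := ε.stab_DeltaTheta_of_induces hC hS hα hβ hind
  obtain ⟨hY, hY'⟩ := ε.stab_GtpYdd_of_map_PiYddtp hα hYmap
  refine ⟨fun hx => ?_, fun hx => ?_⟩
  · obtain ⟨hU, hU'⟩ := ε.stab_Huu_of_mem_tp_PiCuu hα (Subgroup.mem_inf.1 hx).1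
    exact ε.ofEmbedding_transport_outer_rootLZ hC hS (Subgroup.mem_inf.1 hx).2 hα hβ hΔ hΔ' hY hY' hU hU'
      ΓΘ hind hYuu hσ₀ (hη hΔ' hY)
  · obtain ⟨hXu, hXu'⟩ := ε.stab_GtpXu_of_mem_tp_PiCu hXuι hα (Subgroup.mem_inf.1 hx).1
    exact ε.ofEmbedding_transport_outer_etaLZ hC hS (Subgroup.mem_inf.1 hx).2 hα hβ hΔ hΔ' hY hY' hXu hXu'
      ΓΘ hind hYmap ⟨C.Huu_le_GtpXu hσ₀.1, hσ₀.2⟩ (hη hΔ' hY)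

/-- **Cor 2.8 (i) at `ofEmbedding` for an OUTER conjugator, REDUCED binders** (κ = 1, as in
abc-iut-w6-d049's `ofEmbedding_cor28_i_outer`): the stability of `Π^tp_{X̲̲}`, `Π^tp_{X̲}` now comes from
Cor 2.8 (i)'s own tower-stability binders for `γ_x` (`T.tower` members `T.tp T.PiXuu`, `T.tp T.PiXu`), that of
`Δ_Θ`, `Π^tp_Ÿ` from `InducesOnTheta` and `hY`; residual = the pair equations, `hXuι`, P-C5 (`σ₀ ∈ Π^tp_{X̲̲}`).
[cite: MochizukiEtTh2009, Cor 2.8(i) p.42] -/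
theorem ofEmbedding_cor28_i_outer_reduced (hC : D.Compat) (hS : D.Sec2Hyps)
    (hstd : (ThetaOrbitData.ofEmbedding ε hC hS).IsStandard)
    (hα : ∀ g, ε.ι (α g) = x * ε.ι g * x⁻¹) (hβ : ∀ g, β (D.toTheta g) = D.toTheta (α g))
    (hXuι : (D.GtpXu l).map ε.ι = T.tp T.PiXu)
    (ΓΘ : (ThetaOrbitData.ofEmbedding ε hC hS).DeltaTheta ≃* (ThetaOrbitData.ofEmbedding ε hC hS).DeltaTheta)
    (hind : (ThetaOrbitData.ofEmbedding ε hC hS).InducesOnTheta (ThetaOrbitData.innerAutTop x) ΓΘ)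
    (hYmap : T.PiYddtp.map (ThetaOrbitData.innerAutTop x).toMulEquiv.toMonoidHom = T.PiYddtp)
    (hYuu : (T.PiYddtp ⊓ T.tp T.PiXuu).map (ThetaOrbitData.innerAutTop x).toMulEquiv.toMonoidHom =
      T.PiYddtp ⊓ T.tp T.PiXuu)
    (hXuumap : (T.tp T.PiXuu).map (ThetaOrbitData.innerAutTop x).toMulEquiv.toMonoidHom = T.tp T.PiXuu)
    (hXumap : (T.tp T.PiXu).map (ThetaOrbitData.innerAutTop x).toMulEquiv.toMonoidHom = T.tp T.PiXu)
    {σ₀ : D.PiTemp} (hσ₀ : σ₀ ∈ C.Huu)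
    (hη : ∀ (hΔ' : ∀ a, a ∈ D.DeltaTheta → β.symm a ∈ D.DeltaTheta)
        (hY : ∀ g, g ∈ D.GtpYdd → α g ∈ D.GtpYdd),
      haveI := hC.GtpYdd_normal
      ContH1Aut.autMap D.toTheta D.DeltaTheta α.symm β.symm (symm_toTheta_eq hβ) hΔ'
          (H := D.GtpYdd) (H' := D.GtpYdd) hY E.etaDd =
        ContH1.conj D.toTheta D.DeltaTheta σ₀ E.etaDd) :
    (ThetaOrbitData.ofEmbedding ε hC hS).IsStandardColl
        ((ThetaOrbitData.ofEmbedding ε hC hS).transport _ (ThetaOrbitData.innerAutTop x) hYmap ΓΘ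
          (ThetaOrbitData.ofEmbedding ε hC hS).etaZMu2) ∧
      (ThetaOrbitData.ofEmbedding ε hC hS).EqUpToRootOfUnity l _ (ThetaOrbitData.ofEmbedding ε hC hS).rootLZMu2
        ((ThetaOrbitData.ofEmbedding ε hC hS).transport _ (ThetaOrbitData.innerAutTop x) hYuu ΓΘ
          (ThetaOrbitData.ofEmbedding ε hC hS).rootLZMu2) ∧
      (ThetaOrbitData.ofEmbedding ε hC hS).EqUpToRootOfUnity 1 _ (ThetaOrbitData.ofEmbedding ε hC hS).etaZMu2
        ((ThetaOrbitData.ofEmbedding ε hC hS).transport _ (ThetaOrbitData.innerAutTop x) hYmap ΓΘ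
          (ThetaOrbitData.ofEmbedding ε hC hS).etaZMu2) ∧
      (ThetaOrbitData.ofEmbedding ε hC hS).EqUpToRootOfUnity 1 _ (ThetaOrbitData.ofEmbedding ε hC hS).etaLZMu2
        ((ThetaOrbitData.ofEmbedding ε hC hS).transport _ (ThetaOrbitData.innerAutTop x) hYmap ΓΘ
          (ThetaOrbitData.ofEmbedding ε hC hS).etaLZMu2) := by
  obtain ⟨hΔ, hΔ'⟩ := ε.stab_DeltaTheta_of_induces hC hS hα hβ hind
  obtain ⟨hY, hY'⟩ := ε.stab_GtpYdd_of_map_PiYddtp hα hYmap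
  obtain ⟨hU, hU'⟩ := ε.stab_Huu_of_map_tp_PiXuu hα hXuumap
  obtain ⟨hXu, hXu'⟩ := ε.stab_GtpXu_of_map_tp_PiXu hXuι hα hXumap
  exact ε.ofEmbedding_cor28_i_outer hC hS hstd hα hβ hΔ hΔ' hY hY' hXu hXu' hU hU' ΓΘ hind hYmap hYuu hσ₀
    (hη hΔ' hY)

end ThetaSetting.EtaleThetaData.DoubleUnderline.OrbitEmbedding

end Literature.AnabelianGeometry.EtaleTheta

end
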